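import Summits.AtomisticToContinuum.HydrodynamicLimit.Theorems.JParityClosureEvenStressEnskogVelocityEquilibrationRung0MaxwellianContinuity
import HarnessLib

/-!
# Kinetic slaving (stub S3c `stub_kineticSlavingOfTools` of the line `preshock-kinetic-slaving`,
# crux `JParityClosure.EvenStressEnskog`, stmt-AtomisticToContinuum-13079) — first mile:
# the local-Maxwellian pairing is continuous up to the cold boundary `θ = 0⁺` (Dirac limit)

Hazard (h1) of the kinetic-slaving audit: in Lean the zero-temperature Maxwellian is the junk value
`localMaxwellian 1 0 u ≡ 0` (`(2π·0)^{-3/2} = 0`), so the local-Maxwellian prediction `oneBodyPred` of a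
test function `F(v, u, θ)` evaluates to `0` at an EXACT cold spot `θ_r = 0`, whereas the empirical side
`oneBodyStat` evaluates to `ρ_r F(u, u, 0)` there (`integral_mul_localMaxwellian_zero_temperature`).  This
file proves that the discrepancy is a removable junk value and not a discontinuity of the limit: for every
continuous `F` of quadratic growth `|F(v,u,θ)| ≤ C(1 + ‖v‖² + ‖u‖² + |θ|)`,
`∫ F(v, u', θ') M_{1,θ',u'}(v) dv → F(u, u, 0)` as `(u', θ') → (u, 0)` WITHIN the open half-space
`{θ' > 0}` (`tendsto_integral_mul_localMaxwellian_nhdsWithin_zero`): the Gaussian `M_{1,θ',u'}` is an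
approximate identity.  Hence the one-body defect functional `Stat − Pred` of the pre-shock velocity
equilibration statement extends continuously by `0` to Dirac (cold-spot) window laws along
positive-temperature approximants, and no temperature floor is needed in `KineticHalf`.

Proof: on `{θ' > 0}` the pairing is the standard-Gaussian integral `∫ F(u' + √θ' w, u', θ') dN(0,id)(w)`
(`integral_localMaxwellian_mul_eq_integral_gaussMeasure`, `integral_gaussMeasure`, exactly as in the companion
`…VelocityEquilibrationRung0MaxwellianContinuity` for `θ > 0`, whose elementary bounds are reused); that expression is
continuous at `(u, 0)` by dominated convergence (`continuousAt_of_dominated`, majorant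
`C(1 + 3U² + 1 + 2‖w‖²)` on `‖u'‖ ≤ U = ‖u‖ + 1`, `|θ'| ≤ 1`), and its value at `(u, 0)` is
`∫ F(u, u, 0) dN(0,id) = F(u,u,0)` (`√0 = 0`, probability measure).

References: standard (approximate identity / dominated convergence); H. Spohn, *Large Scale Dynamics of
Interacting Particles* (1991), Part I §2.3 for the setting (local Maxwellians).
-/

noncomputable section

open MeasureTheory ProbabilityTheory Filter Set Topology
open scoped ENNReal InnerProductSpace BigOperators

namespace Summit.AtomisticToContinuum.HydrodynamicLimit.Theorems.EvenStressEnskog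

open Literature.Analysis.FluidPDE Literature.MathematicalPhysics.KineticTheory

/-- **The junk value at an exact cold spot**: the zero-temperature local Maxwellian vanishes identically,
so every pairing against it is `0` (whereas the Dirac limit of the pairing is `F(u,u,0)`,
`tendsto_integral_mul_localMaxwellian_nhdsWithin_zero`). [folklore] -/
theorem integral_mul_localMaxwellian_zero_temperature (F : V3 × V3 × ℝ → ℝ) (u : V3) :
    ∫ v, F (v, u, 0) * localMaxwellian 1 0 u v = 0 := by
  have h : ∀ v : V3, localMaxwellian 1 0 u v = 0 := fun v => by
    simp [localMaxwellian]
  simp [h]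

/-- **Continuity of the standard-Gaussian form of the pairing at the cold boundary.**  For continuous `F`
of quadratic growth, `p ↦ ∫ F(p.1 + √p.2 • w, p.1, p.2) dN(0, id)(w)` is continuous at `(u, 0)`
(dominated convergence; `√p.2 = 0` for `p.2 ≤ 0`, so the expression is defined and continuous across the
boundary even though it represents the Maxwellian pairing only for `p.2 > 0`). [folklore] -/
theorem continuousAt_integral_gaussShift_zero {F : V3 × V3 × ℝ → ℝ} (hF : Continuous F)
    (hC : ∃ C : ℝ, ∀ q, |F q| ≤ C * (1 + ‖q.1‖ ^ 2 + ‖q.2.1‖ ^ 2 + |q.2.2|)) (u : V3) :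
    ContinuousAt (fun p : V3 × ℝ => ∫ w, F (p.1 + Real.sqrt p.2 • w, p.1, p.2) ∂stdGaussian V3)
      (u, 0) := by
  obtain ⟨C, hC⟩ := hC
  have hC0 : 0 ≤ C := by
    have h := hC ((0 : V3), (0 : V3), (0 : ℝ))
    simp only [norm_zero, abs_zero] at h
    have : (0 : ℝ) ≤ C * (1 + 0 ^ 2 + 0 ^ 2 + 0) := (abs_nonneg _).trans h
    linarith
  set U : ℝ := ‖u‖ + 1 with hU
  have hsq : Integrable (fun w : V3 => ‖w‖ ^ 2) (stdGaussian V3) :=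
    (IsGaussian.memLp_id _ 2 (by simp)).integrable_norm_pow (by norm_num)
  have hball : ∀ᶠ p : V3 × ℝ in 𝓝 (u, (0 : ℝ)), ‖p.1‖ ≤ U ∧ |p.2| ≤ 1 := by
    have h1 : ∀ᶠ p : V3 × ℝ in 𝓝 (u, (0 : ℝ)), dist p.1 u < 1 :=
      Metric.tendsto_nhds.1 ((continuous_fst (X := V3) (Y := ℝ)).tendsto (u, 0)) 1 one_pos
    have h2 : ∀ᶠ p : V3 × ℝ in 𝓝 (u, (0 : ℝ)), dist p.2 0 < 1 :=
      Metric.tendsto_nhds.1 ((continuous_snd (X := V3) (Y := ℝ)).tendsto (u, 0)) 1 one_pos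
    filter_upwards [h1, h2] with p hp1 hp2
    rw [dist_eq_norm] at hp1
    rw [Real.dist_eq, sub_zero] at hp2
    constructor
    · calc ‖p.1‖ = ‖(p.1 - u) + u‖ := by rw [sub_add_cancel]
        _ ≤ ‖p.1 - u‖ + ‖u‖ := norm_add_le _ _
        _ ≤ U := by rw [hU]; linarith
    · exact hp2.le
  refine continuousAt_of_dominated
    (bound := fun w : V3 => C * (1 + 3 * U ^ 2 + 1 + 2 * ‖w‖ ^ 2)) ?_ ?_ ?_ ?_
  · refine Eventually.of_forall fun p => Continuous.aestronglyMeasurable ?_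
    have hc : Continuous fun w : V3 => (p.1 + Real.sqrt p.2 • w, p.1, p.2) := by fun_prop
    exact hF.comp hc
  · filter_upwards [hball] with p hp
    refine ae_of_all _ fun w => ?_
    rw [Real.norm_eq_abs]
    refine (hC _).trans ?_
    dsimp only
    have h1 := norm_add_smul_sq_le p.1 w (Real.sqrt p.2)
    have h2 : Real.sqrt p.2 ^ 2 ≤ 1 := (sq_sqrt_le_abs p.2).trans hp.2
    have h3 : ‖p.1‖ ^ 2 ≤ U ^ 2 := pow_le_pow_left₀ (norm_nonneg _) hp.1 2
    have h4 : Real.sqrt p.2 ^ 2 * ‖w‖ ^ 2 ≤ 1 * ‖w‖ ^ 2 :=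
      mul_le_mul_of_nonneg_right h2 (sq_nonneg _)
    refine mul_le_mul_of_nonneg_left ?_ hC0
    nlinarith [hp.2, sq_nonneg ‖w‖]
  · exact ((integrable_const _).add (hsq.const_mul _)).const_mul _
  · refine Eventually.of_forall fun w => Continuous.continuousAt ?_
    have hc : Continuous fun p : V3 × ℝ => (p.1 + Real.sqrt p.2 • w, p.1, p.2) :=
      (continuous_fst.add ((Real.continuous_sqrt.comp continuous_snd).smul continuous_const)).prodMk
        (continuous_fst.prodMk continuous_snd)
    exact hF.comp hc

/-- **The Maxwellian pairing is continuous up to the cold boundary (Dirac limit).**  For a continuous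
`F` with `|F(v,u,θ)| ≤ C(1 + ‖v‖² + ‖u‖² + |θ|)` and every `u`,
`∫ F(v, u', θ') M_{1,θ',u'}(v) dv → F(u, u, 0)` as `(u', θ') → (u, 0)` within `{θ' > 0}`.
(At `θ' = 0` itself the pairing is the junk value `0`, `integral_mul_localMaxwellian_zero_temperature`;
the limit along positive temperatures is the Dirac value.) [folklore] -/
theorem tendsto_integral_mul_localMaxwellian_nhdsWithin_zero :
    ∀ {F : V3 × V3 × ℝ → ℝ}, Continuous F →
    (∃ C : ℝ, ∀ q, |F q| ≤ C * (1 + ‖q.1‖ ^ 2 + ‖q.2.1‖ ^ 2 + |q.2.2|)) →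
    ∀ u : V3,
      Tendsto (fun p : V3 × ℝ => ∫ v, F (v, p.1, p.2) * localMaxwellian 1 p.2 p.1 v)
        (𝓝[{p : V3 × ℝ | 0 < p.2}] (u, 0)) (𝓝 (F (u, u, 0))) := by
  intro F hF hC u
  -- the Gaussian form is continuous at `(u, 0)` with value `F(u,u,0)`
  have hcont := continuousAt_integral_gaussShift_zero hF hC u
  have hval : (∫ w, F (u + Real.sqrt 0 • w, u, (0 : ℝ)) ∂stdGaussian V3) = F (u, u, 0) := by
    simp only [Real.sqrt_zero, zero_smul, add_zero]
    rw [integral_const, smul_eq_mul]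
    simp
  have hT : Tendsto (fun p : V3 × ℝ => ∫ w, F (p.1 + Real.sqrt p.2 • w, p.1, p.2) ∂stdGaussian V3)
      (𝓝[{p : V3 × ℝ | 0 < p.2}] (u, 0)) (𝓝 (F (u, u, 0))) := by
    have h : Tendsto (fun p : V3 × ℝ => ∫ w, F (p.1 + Real.sqrt p.2 • w, p.1, p.2) ∂stdGaussian V3)
        (𝓝 (u, 0)) (𝓝 (F (u, u, 0))) := by
      have h0 := hcont.tendsto
      dsimp only at h0
      rwa [hval] at h0
    exact h.mono_left nhdsWithin_le_nhds
  -- on the open half-space the two expressions agree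
  refine hT.congr' ?_
  filter_upwards [self_mem_nhdsWithin] with p hp
  have hp' : 0 < p.2 := hp
  rw [← integral_gaussMeasure p.1 hp' (fun v => F (v, p.1, p.2)),
    ← integral_localMaxwellian_mul_eq_integral_gaussMeasure hp' p.1]
  exact integral_congr_ae (ae_of_all _ fun v => mul_comm _ _)

end Summit.AtomisticToContinuum.HydrodynamicLimit.Theorems.EvenStressEnskog

end
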